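import Summits.QuantumFields.BalabanUV.Beta.D1BFx.LogDetSecondVariation
import Literature.MathematicalPhysics.QuantumFieldTheory.Balaban1983to89.Beta.Envelope

/-!
# `BalabanUV.Beta.FP.InducedPolarizationLoops` — road «FP» for binder row D1, rows **RHOA-6a** and **RHOA-2 (C-sector, jet level)** of
# `RHOA-DESIGN.md` v1.1 (owner d1-p3-g6): the one-loop expansion of the INDUCED COARSE POLARIZATION `½·δ² log det (Q·H⁻¹·Qᵀ)` along a
# two-jet of the fine form `H` and of the averaging `Q`, REGROUPED INTO BAŁABAN's OBJECTS — the interpolation `𝓘 = H⁻¹Qᵀ(QH⁻¹Qᵀ)⁻¹`,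
# the constrained covariance `Γ₀ = H⁻¹ − 𝓘QH⁻¹`, the range term `R^Q = 𝓘QH⁻¹` — and the CHECK that the fine one-loop functional minus it is
# Bałaban's one shot with legs `Γ₀`.  Pure finite-dimensional matrix algebra.

HONEST DEPENDENCY (cell records, verbatim): «continuum YM on T⁴ ⇐ BetaPertH ∧ nine spine estimates (0/9 proved); BetaPertH ⇐ (D1) ∧ (D4) ∧
CAP+tail; G-an2-4 gates asym, D1 and NE2/3/4.»  HONEST FRAMING (cell contract, verbatim): «discharging `BetaPertH` makes Bałaban's UV stability
UNCONDITIONAL — a real constructive-QFT result; it is NOT the continuum limit and NOT the Clay problem.»  THIS MODULE is [folklore] matrix algebra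
(Mathlib traces, transposes, inverses) over ABSTRACT matrices `H, Q, H₁, H₂, Q₁, Q₂`; it contains NO estimate, NO lattice object, nothing of Bałaban's
manuscripts, no definition, no `def … : Prop`, nothing cited, 0 sorry.  It discharges NOTHING of `hbook`∕`hasym`∕D1.  NOT D1, NOT BetaPertH, NOT
continuum, NOT Clay.

ABSOLUTE RULE (cell charter, verbatim): «No internally-minted statement may enter as a cited fact. Every hypothesis is either kernel-proved in this
package or a verbatim quotation of a PUBLISHED theorem with page reference. The manuscript(s) under audit are NOT citable for their own disputed
steps — they are the thing under adjudication; programme-internal (2001/route/tribunal) claims are never citable.»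

WHERE THIS SITS (`HOME/b2b-balaban-beta-d1-p3/RHOA-DESIGN.md` §0–§2, §2bis, §5 rows RHOA-2 ∕ RHOA-6a).  The remainder `ρ_n` of the H′ bookkeeping
is a second moment of `K̃_n := δ²_V[½ log|det C_n| + ½ log det L_C]`, `C_n(B) = Q_B·H_BF(B)⁻¹·Q_Bᵀ`.  The owner's LOOP CATALOGUE (§2 (i)–(ii)) expands
`½·δ² log det C` along the background jet (`Ḣ`, `Ḧ` of the fine form, `Q̇`, `Q̈` of the averaging) and §2bis (MIX-1…4) regroups the averaging-vertex loops
into Bałaban's objects.  THIS FILE does exactly that expansion at JET level: with `P = H⁻¹`, `A = P·Qᵀ`, `C = blockProp H Q = Q·P·Qᵀ`, `G = C⁻¹`,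
`𝓘 = minMap H Q = A·G`, `R^Q := 𝓘·Q·P` (`= A·G·Aᵀ`), `Γ₀ = constrProp H Q = P − R^Q` (all `Beta.Envelope` ∕ `Beta.Composition` objects BY NAME), and
the DISPLAYED jets `C₁ = Q₁A + (QP)Q₁ᵀ − (QP)H₁A` (`Ṗ = −PḢP` applied), `C₂ = Q₂A + (QP)Q₂ᵀ − 2·Q₁PH₁A − 2·(QP)H₁PQ₁ᵀ + 2·Q₁PQ₁ᵀ + 2·(QP)H₁PH₁A − (QP)H₂A`
(`P̈ = 2PḢPḢP − PḦP` applied; `QP` is `Aᵀ` for symmetric `H`), the one-loop functional `secondVar C C₁ C₂ = tr(GC₂) − tr(GC₁GC₁)`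
(`D1BFx.LogDetSecondVariation.secondVar` — twice the owner's `½`-normalised loops) is
`2tr(Q₂𝓘) − 2tr(Q₁𝓘Q₁𝓘) + 2tr(GQ₁Γ₀Q₁ᵀ) − 4tr(Q₁Γ₀H₁𝓘) + 2tr(R^QH₁PH₁) − tr(R^QH₁R^QH₁) − tr(R^QH₂)`.

CONTENT (all [folklore]).
* §1 BOOKKEEPING for symmetric `H`: `(H⁻¹)ᵀ = H⁻¹`, `(blockProp H Q)ᵀ = blockProp H Q`, its inverse likewise, `(H⁻¹Qᵀ)ᵀ = QH⁻¹`, `(minMap H Q)ᵀ = G·Q·H⁻¹`,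
  `H⁻¹·Qᵀ·G = minMap H Q` (rfl), `minMap·Q·H⁻¹ = H⁻¹Qᵀ·G·(QH⁻¹)`, `constrProp = H⁻¹ − minMap·Q·H⁻¹` (rfl).
* §2 = ROW RHOA-6a, the memo's four lines VERBATIM: **`mix₁`** `tr(GQ̇PQ̇ᵀ) − tr(GQ̇R^QQ̇ᵀ) = tr(GQ̇Γ₀Q̇ᵀ)`; **`mix₂`** `tr(G(Q̇A)G(Q̇A)) = tr(Q̇𝓘Q̇𝓘)`;
  **`mix₃`** `tr(GQ̇AG(QP)ḢA) − tr(GQ̇PḢA) = −tr(Q̇Γ₀Ḣ𝓘)` (no symmetry needed in this dress) and its transpose twin **`mix₃_twin`**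
  (`tr(G(QP)ḢPQ̇ᵀ) = tr(GQ̇PḢA)` for symmetric `H`, `Ḣ`); **`mix₄`** `½(tr(GQ̈A) + tr(G(QP)Q̈ᵀ)) = tr(Q̈𝓘)`.
* §3 = ROW RHOA-2, C-SECTOR: the TADPOLE `trace_inv_mul_jet₂` (`tr(GC₂)` expanded) and the BUBBLE `trace_bubble_jet₁` (`tr(GC₁GC₁)` expanded), then
  **`secondVar_blockProp_jets`** (the display above).
* §4 THE REGROUPING CHECK (memo §2 (ii) «CHECK ✓»): **`oneShot_regroup`**
  `½(tr(PḢPḢ) − tr(PḦ)) − (tr(R^QḢPḢ) − ½tr(R^QḢR^QḢ) − ½tr(R^QḦ)) = ½tr(Γ₀ḢΓ₀Ḣ) − ½tr(Γ₀Ḧ)` — the fine unconstrained one loop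
  (`T¹ = −½·secondVar H`) minus the pure-`H` part of the induced polarization IS Bałaban's one shot with the constrained covariance.
NOT HERE: the CURVE form («`C₁`, `C₂` are the `u`-derivatives of `u ↦ blockProp (H u) (Q u)`», sequel `FP/InducedPolarizationCurve`), the L-sector
(iii) (`L_C = d^{cT}G_Cd^c`, `Ξ`; row RHOA-6d), tadpole-freeness (S4), any estimate.
Provenance: D1 formalisation swarm leaf seat `b2b-balaban-beta-d1-formalise-leaf-05` gen 11 (road «FP» rows RHOA-6a ∕ RHOA-2, CLAIM journal
2026-08-20T23:49Z), 2026-08-20∕21.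
-/

noncomputable section

namespace Summit.QuantumFields.BalabanUV.Beta.FP.InducedPolarizationLoops

open Matrix
open Literature.MathematicalPhysics.QuantumFieldTheory.Balaban1983to89.Beta.Composition (blockProp)
open Literature.MathematicalPhysics.QuantumFieldTheory.Balaban1983to89.Beta.Envelope (minMap constrProp blockProp_eq)
open Summit.QuantumFields.BalabanUV.Beta.D1BFx.LogDetSecondVariation (secondVar)

variable {ν μ : Type*} [Fintype ν] [Fintype μ] [DecidableEq ν] [DecidableEq μ]

/-! ## §1 Bookkeeping: the objects for a symmetric fine form -/

omit [Fintype μ] [DecidableEq μ] in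
/-- [folklore] The inverse of a symmetric matrix is symmetric. -/
theorem inv_transpose_of_symm {H : Matrix ν ν ℝ} (hH : Hᵀ = H) : (H⁻¹)ᵀ = H⁻¹ := by
  rw [Matrix.transpose_nonsing_inv, hH]

omit [Fintype μ] [DecidableEq μ] in
/-- [folklore] `(H⁻¹·Qᵀ)ᵀ = Q·H⁻¹` for symmetric `H` (the «`Aᵀ = QP`» of the header). -/
theorem transpose_inv_mul_transpose {H : Matrix ν ν ℝ} (hH : Hᵀ = H) (Q : Matrix μ ν ℝ) : (H⁻¹ * Qᵀ)ᵀ = Q * H⁻¹ := by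
  rw [Matrix.transpose_mul, Matrix.transpose_transpose, inv_transpose_of_symm hH]

omit [Fintype μ] [DecidableEq μ] in
/-- [folklore] The block propagator `C = Q·H⁻¹·Qᵀ` of a symmetric form is symmetric. -/
theorem blockProp_transpose_of_symm {H : Matrix ν ν ℝ} (hH : Hᵀ = H) (Q : Matrix μ ν ℝ) : (blockProp H Q)ᵀ = blockProp H Q := by
  rw [blockProp_eq, Matrix.transpose_mul, Matrix.transpose_mul, Matrix.transpose_transpose, inv_transpose_of_symm hH, Matrix.mul_assoc]

/-- [folklore] `G = C⁻¹` is symmetric for symmetric `H`. -/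
theorem inv_blockProp_transpose_of_symm {H : Matrix ν ν ℝ} (hH : Hᵀ = H) (Q : Matrix μ ν ℝ) :
    ((blockProp H Q)⁻¹)ᵀ = (blockProp H Q)⁻¹ := by
  rw [Matrix.transpose_nonsing_inv, blockProp_transpose_of_symm hH]

/-- [folklore] `H⁻¹·Qᵀ·G = 𝓘` (`Envelope.minMap`, definitional). -/
theorem inv_mul_transpose_mul_inv_blockProp (H : Matrix ν ν ℝ) (Q : Matrix μ ν ℝ) :
    H⁻¹ * Qᵀ * (blockProp H Q)⁻¹ = minMap H Q := rfl

/-- [folklore] `Γ₀ = P − R^Q` (`Envelope.constrProp`, definitional). -/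
theorem constrProp_eq_sub (H : Matrix ν ν ℝ) (Q : Matrix μ ν ℝ) : constrProp H Q = H⁻¹ - minMap H Q * Q * H⁻¹ := rfl

/-- [folklore] `𝓘ᵀ = G·Q·P` for symmetric `H` (`= Envelope.minMapL`, cf. `minMapL_eq_transpose`). -/
theorem minMap_transpose_of_symm {H : Matrix ν ν ℝ} (hH : Hᵀ = H) (Q : Matrix μ ν ℝ) :
    (minMap H Q)ᵀ = (blockProp H Q)⁻¹ * Q * H⁻¹ := by
  rw [← inv_mul_transpose_mul_inv_blockProp, Matrix.transpose_mul, inv_blockProp_transpose_of_symm hH,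
    transpose_inv_mul_transpose hH, ← Matrix.mul_assoc]

/-- [folklore] The range term in `A·G·Aᵀ` dress: `(H⁻¹Qᵀ)·G·(QH⁻¹) = 𝓘·Q·H⁻¹ = R^Q`. -/
theorem range_term_eq (H : Matrix ν ν ℝ) (Q : Matrix μ ν ℝ) :
    H⁻¹ * Qᵀ * (blockProp H Q)⁻¹ * (Q * H⁻¹) = minMap H Q * Q * H⁻¹ := by
  rw [inv_mul_transpose_mul_inv_blockProp, Matrix.mul_assoc]

/-! ## §2 Row RHOA-6a: the MIX loops recombine into Bałaban's objects -/

/-- [folklore] **(MIX-1)** `tr(G·Q̇·P·Q̇ᵀ) − tr(G·Q̇·R^Q·Q̇ᵀ) = tr(G·Q̇·Γ₀·Q̇ᵀ)` — two averaging 3-jets joined by the CONSTRAINED covariance and by `G_C`. -/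
theorem mix₁ (H : Matrix ν ν ℝ) (Q Q₁ : Matrix μ ν ℝ) :
    ((blockProp H Q)⁻¹ * Q₁ * H⁻¹ * Q₁ᵀ).trace - ((blockProp H Q)⁻¹ * Q₁ * (minMap H Q * Q * H⁻¹) * Q₁ᵀ).trace
      = ((blockProp H Q)⁻¹ * Q₁ * constrProp H Q * Q₁ᵀ).trace := by
  rw [constrProp_eq_sub, Matrix.mul_sub, Matrix.sub_mul, Matrix.trace_sub, Matrix.mul_assoc ((blockProp H Q)⁻¹ * Q₁) H⁻¹]

/-- [folklore] **(MIX-2)** `tr(G·(Q̇A)·G·(Q̇A)) = tr(Q̇𝓘·Q̇𝓘)` (`A = H⁻¹Qᵀ`, `𝓘 = A·G`) — two averaging 3-jets, two interpolations. -/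
theorem mix₂ (H : Matrix ν ν ℝ) (Q Q₁ : Matrix μ ν ℝ) :
    ((blockProp H Q)⁻¹ * (Q₁ * (H⁻¹ * Qᵀ)) * ((blockProp H Q)⁻¹ * (Q₁ * (H⁻¹ * Qᵀ)))).trace
      = (Q₁ * minMap H Q * (Q₁ * minMap H Q)).trace := by
  rw [Matrix.mul_assoc (blockProp H Q)⁻¹, Matrix.trace_mul_comm, ← inv_mul_transpose_mul_inv_blockProp]
  simp only [Matrix.mul_assoc]

/-- [folklore] **(MIX-3)** `tr(G·Q̇·A·G·(QP)·Ḣ·A) − tr(G·Q̇·P·Ḣ·A) = −tr(Q̇·Γ₀·Ḣ·𝓘)` — one averaging 3-jet, one action∕slice 3-jet; the legs `P`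
and `R^Q` RECOMBINE into `Γ₀` (forced).  Written with `QP` for `Aᵀ`, so no symmetry is needed. -/
theorem mix₃ (H H₁ : Matrix ν ν ℝ) (Q Q₁ : Matrix μ ν ℝ) :
    ((blockProp H Q)⁻¹ * Q₁ * (H⁻¹ * Qᵀ) * (blockProp H Q)⁻¹ * (Q * H⁻¹) * H₁ * (H⁻¹ * Qᵀ)).trace
      - ((blockProp H Q)⁻¹ * Q₁ * H⁻¹ * H₁ * (H⁻¹ * Qᵀ)).trace
      = -(Q₁ * constrProp H Q * H₁ * minMap H Q).trace := by
  -- rotate the leading `G` to the end in both traces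
  have e1 : ((blockProp H Q)⁻¹ * Q₁ * (H⁻¹ * Qᵀ) * (blockProp H Q)⁻¹ * (Q * H⁻¹) * H₁ * (H⁻¹ * Qᵀ)).trace
      = (Q₁ * (minMap H Q * Q * H⁻¹) * H₁ * minMap H Q).trace := by
    rw [show (blockProp H Q)⁻¹ * Q₁ * (H⁻¹ * Qᵀ) * (blockProp H Q)⁻¹ * (Q * H⁻¹) * H₁ * (H⁻¹ * Qᵀ)
        = (blockProp H Q)⁻¹ * (Q₁ * (H⁻¹ * Qᵀ) * (blockProp H Q)⁻¹ * (Q * H⁻¹) * H₁ * (H⁻¹ * Qᵀ)) by simp only [Matrix.mul_assoc],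
      Matrix.trace_mul_comm, ← inv_mul_transpose_mul_inv_blockProp]
    simp only [Matrix.mul_assoc]
  have e2 : ((blockProp H Q)⁻¹ * Q₁ * H⁻¹ * H₁ * (H⁻¹ * Qᵀ)).trace = (Q₁ * H⁻¹ * H₁ * minMap H Q).trace := by
    rw [show (blockProp H Q)⁻¹ * Q₁ * H⁻¹ * H₁ * (H⁻¹ * Qᵀ) = (blockProp H Q)⁻¹ * (Q₁ * H⁻¹ * H₁ * (H⁻¹ * Qᵀ)) by
        simp only [Matrix.mul_assoc], Matrix.trace_mul_comm, ← inv_mul_transpose_mul_inv_blockProp]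
    simp only [Matrix.mul_assoc]
  rw [e1, e2, constrProp_eq_sub, Matrix.mul_sub, Matrix.sub_mul, Matrix.sub_mul, Matrix.trace_sub]
  ring

/-- [folklore] The TRANSPOSE TWIN of (MIX-3)'s second term: for symmetric `H`, `Ḣ`, `tr(G·(QP)·Ḣ·P·Q̇ᵀ) = tr(G·Q̇·P·Ḣ·A)` — so the two
cross terms of `½tr(Gδ²C)` are equal and (MIX-3) enters with the factor `2`. -/
theorem mix₃_twin {H H₁ : Matrix ν ν ℝ} (hH : Hᵀ = H) (hH₁ : H₁ᵀ = H₁) (Q Q₁ : Matrix μ ν ℝ) :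
    ((blockProp H Q)⁻¹ * (Q * H⁻¹) * H₁ * H⁻¹ * Q₁ᵀ).trace = ((blockProp H Q)⁻¹ * Q₁ * H⁻¹ * H₁ * (H⁻¹ * Qᵀ)).trace := by
  rw [← Matrix.trace_transpose ((blockProp H Q)⁻¹ * Q₁ * H⁻¹ * H₁ * (H⁻¹ * Qᵀ))]
  simp only [Matrix.transpose_mul, Matrix.transpose_transpose, inv_transpose_of_symm hH, inv_blockProp_transpose_of_symm hH, hH₁,
    Matrix.mul_assoc]
  -- `tr(Q·P·Ḣ·P·Q̇ᵀ·G) = tr(G·Q·P·Ḣ·P·Q̇ᵀ)`: rotate `G` to the front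
  rw [show Q * (H⁻¹ * (H₁ * (H⁻¹ * (Q₁ᵀ * (blockProp H Q)⁻¹)))) = (Q * (H⁻¹ * (H₁ * (H⁻¹ * Q₁ᵀ)))) * (blockProp H Q)⁻¹ by
      simp only [Matrix.mul_assoc],
    Matrix.trace_mul_comm (Q * (H⁻¹ * (H₁ * (H⁻¹ * Q₁ᵀ)))) (blockProp H Q)⁻¹]

/-- [folklore] **(MIX-4)** `½(tr(G·Q̈·A) + tr(G·(QP)·Q̈ᵀ)) = tr(Q̈·𝓘)` — the averaging 4-jet tadpole on the interpolation (symmetric `H`). -/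
theorem mix₄ {H : Matrix ν ν ℝ} (hH : Hᵀ = H) (Q Q₂ : Matrix μ ν ℝ) :
    (1 / 2 : ℝ) * (((blockProp H Q)⁻¹ * (Q₂ * (H⁻¹ * Qᵀ))).trace + ((blockProp H Q)⁻¹ * ((Q * H⁻¹) * Q₂ᵀ)).trace)
      = (Q₂ * minMap H Q).trace := by
  have e1 : ((blockProp H Q)⁻¹ * (Q₂ * (H⁻¹ * Qᵀ))).trace = (Q₂ * minMap H Q).trace := by
    rw [Matrix.trace_mul_comm, ← inv_mul_transpose_mul_inv_blockProp]
    simp only [Matrix.mul_assoc]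
  have e2 : ((blockProp H Q)⁻¹ * ((Q * H⁻¹) * Q₂ᵀ)).trace = (Q₂ * minMap H Q).trace := by
    rw [← Matrix.trace_transpose]
    simp only [Matrix.transpose_mul, Matrix.transpose_transpose, inv_transpose_of_symm hH, inv_blockProp_transpose_of_symm hH,
      ← inv_mul_transpose_mul_inv_blockProp, Matrix.mul_assoc]
  rw [e1, e2]
  ring

/-! ## §3 Row RHOA-2, C-sector: the induced polarization loops at jet level -/

/-- [folklore] THE TADPOLE of the second jet: `tr(G·C₂)` for the displayed `C₂`, in Bałaban's objects:
`2tr(Q̈𝓘) − 4tr(Q̇PḢ𝓘) + 2tr(GQ̇PQ̇ᵀ) + 2tr(R^QḢPḢ) − tr(R^QḦ)`. -/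
theorem trace_inv_mul_jet₂ {H H₁ : Matrix ν ν ℝ} (hH : Hᵀ = H) (hH₁ : H₁ᵀ = H₁) (H₂ : Matrix ν ν ℝ) (Q Q₁ Q₂ : Matrix μ ν ℝ)
    (C₂ : Matrix μ μ ℝ)
    (hC₂ : C₂ = Q₂ * (H⁻¹ * Qᵀ) + (Q * H⁻¹) * Q₂ᵀ - (2 : ℝ) • (Q₁ * H⁻¹ * H₁ * (H⁻¹ * Qᵀ)) - (2 : ℝ) • ((Q * H⁻¹) * H₁ * H⁻¹ * Q₁ᵀ)
      + (2 : ℝ) • (Q₁ * H⁻¹ * Q₁ᵀ) + (2 : ℝ) • ((Q * H⁻¹) * H₁ * H⁻¹ * H₁ * (H⁻¹ * Qᵀ)) - (Q * H⁻¹) * H₂ * (H⁻¹ * Qᵀ)) :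
    ((blockProp H Q)⁻¹ * C₂).trace
      = 2 * (Q₂ * minMap H Q).trace - 4 * (Q₁ * H⁻¹ * H₁ * minMap H Q).trace + 2 * ((blockProp H Q)⁻¹ * Q₁ * H⁻¹ * Q₁ᵀ).trace
        + 2 * (minMap H Q * Q * H⁻¹ * H₁ * H⁻¹ * H₁).trace - (minMap H Q * Q * H⁻¹ * H₂).trace := by
  set G := (blockProp H Q)⁻¹ with hG
  -- the five monomials
  have t1 : (G * (Q₂ * (H⁻¹ * Qᵀ))).trace + (G * ((Q * H⁻¹) * Q₂ᵀ)).trace = 2 * (Q₂ * minMap H Q).trace := by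
    have := mix₄ hH Q Q₂
    rw [← hG] at this
    linarith
  have t2 : (G * (Q₁ * H⁻¹ * H₁ * (H⁻¹ * Qᵀ))).trace = (Q₁ * H⁻¹ * H₁ * minMap H Q).trace := by
    rw [Matrix.trace_mul_comm, hG, ← inv_mul_transpose_mul_inv_blockProp]
    simp only [Matrix.mul_assoc]
  have t3 : (G * ((Q * H⁻¹) * H₁ * H⁻¹ * Q₁ᵀ)).trace = (Q₁ * H⁻¹ * H₁ * minMap H Q).trace := by
    rw [← t2, hG, show (blockProp H Q)⁻¹ * ((Q * H⁻¹) * H₁ * H⁻¹ * Q₁ᵀ) = (blockProp H Q)⁻¹ * (Q * H⁻¹) * H₁ * H⁻¹ * Q₁ᵀ by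
      simp only [Matrix.mul_assoc], mix₃_twin hH hH₁]
    simp only [Matrix.mul_assoc]
  have t4 : (G * (Q₁ * H⁻¹ * Q₁ᵀ)).trace = (G * Q₁ * H⁻¹ * Q₁ᵀ).trace := by simp only [Matrix.mul_assoc]
  have t5 : (G * ((Q * H⁻¹) * H₁ * H⁻¹ * H₁ * (H⁻¹ * Qᵀ))).trace = (minMap H Q * Q * H⁻¹ * H₁ * H⁻¹ * H₁).trace := by
    -- rotate the trailing `A = H⁻¹Qᵀ` to the front: `tr(A·G·(QP)·Ḣ·P·Ḣ) = tr(R^Q·Ḣ·P·Ḣ)`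
    rw [← Matrix.mul_assoc, Matrix.trace_mul_comm, ← range_term_eq, hG]
    simp only [Matrix.mul_assoc]
  have t6 : (G * ((Q * H⁻¹) * H₂ * (H⁻¹ * Qᵀ))).trace = (minMap H Q * Q * H⁻¹ * H₂).trace := by
    rw [← Matrix.mul_assoc, Matrix.trace_mul_comm, ← range_term_eq, hG]
    simp only [Matrix.mul_assoc]
  rw [hC₂]
  simp only [Matrix.mul_add, Matrix.mul_sub, Matrix.mul_smul, Matrix.trace_add, Matrix.trace_sub, Matrix.trace_smul, smul_eq_mul]
  rw [t2, t3, t4, t5, t6]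
  linarith [t1]

/-- [folklore] THE BUBBLE of the first jet: `tr(G·C₁·G·C₁)` for the displayed `C₁ = Q̇A + (QP)Q̇ᵀ − (QP)ḢA`, in Bałaban's objects:
`2tr(Q̇𝓘Q̇𝓘) + 2tr(GQ̇R^QQ̇ᵀ) − 4tr(Q̇R^QḢ𝓘) + tr(R^QḢR^QḢ)` (symmetric `H`, `Ḣ`: the nine terms pair up by cyclicity and transposition). -/
theorem trace_bubble_jet₁ {H H₁ : Matrix ν ν ℝ} (hH : Hᵀ = H) (hH₁ : H₁ᵀ = H₁) (Q Q₁ : Matrix μ ν ℝ) (C₁ : Matrix μ μ ℝ)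
    (hC₁ : C₁ = Q₁ * (H⁻¹ * Qᵀ) + (Q * H⁻¹) * Q₁ᵀ - (Q * H⁻¹) * H₁ * (H⁻¹ * Qᵀ)) :
    ((blockProp H Q)⁻¹ * C₁ * ((blockProp H Q)⁻¹ * C₁)).trace
      = 2 * (Q₁ * minMap H Q * (Q₁ * minMap H Q)).trace + 2 * ((blockProp H Q)⁻¹ * Q₁ * (minMap H Q * Q * H⁻¹) * Q₁ᵀ).trace
        - 4 * (Q₁ * (minMap H Q * Q * H⁻¹) * H₁ * minMap H Q).trace
        + (minMap H Q * Q * H⁻¹ * H₁ * (minMap H Q * Q * H⁻¹ * H₁)).trace := by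
  set G := (blockProp H Q)⁻¹ with hG
  set X : Matrix μ μ ℝ := Q₁ * (H⁻¹ * Qᵀ) with hX
  set X' : Matrix μ μ ℝ := (Q * H⁻¹) * Q₁ᵀ with hX'
  set Y : Matrix μ μ ℝ := (Q * H⁻¹) * H₁ * (H⁻¹ * Qᵀ) with hY
  have hGt : Gᵀ = G := by rw [hG]; exact inv_blockProp_transpose_of_symm hH Q
  have hXt : Xᵀ = X' := by
    rw [hX, hX', Matrix.transpose_mul, transpose_inv_mul_transpose hH]
  have hX't : X'ᵀ = X := by rw [← hXt, Matrix.transpose_transpose]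
  have hYt : Yᵀ = Y := by
    rw [hY]
    simp only [Matrix.transpose_mul, Matrix.transpose_transpose, inv_transpose_of_symm hH, hH₁, Matrix.mul_assoc]
  -- transposition twins: `tr(G·U·G·V) = tr(G·Vᵀ·G·Uᵀ)`
  have twin : ∀ U V : Matrix μ μ ℝ, (G * U * (G * V)).trace = (G * Vᵀ * (G * Uᵀ)).trace := by
    intro U V
    rw [← Matrix.trace_transpose (G * U * (G * V)), Matrix.transpose_mul, Matrix.transpose_mul, Matrix.transpose_mul, hGt,
      show Vᵀ * G * (Uᵀ * G) = Vᵀ * (G * Uᵀ) * G by simp only [Matrix.mul_assoc], Matrix.trace_mul_comm, ← Matrix.mul_assoc]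
  -- cyclic twins: `tr(G·U·G·V) = tr(G·V·G·U)`
  have cyc : ∀ U V : Matrix μ μ ℝ, (G * U * (G * V)).trace = (G * V * (G * U)).trace := fun U V => Matrix.trace_mul_comm _ _
  -- the four basic monomials in Bałaban's objects
  have mXX : (G * X * (G * X)).trace = (Q₁ * minMap H Q * (Q₁ * minMap H Q)).trace := by rw [hG, hX]; exact mix₂ H Q Q₁
  have mXX' : (G * X * (G * X')).trace = (G * Q₁ * (minMap H Q * Q * H⁻¹) * Q₁ᵀ).trace := by
    rw [hX, hX', ← range_term_eq, hG]
    simp only [Matrix.mul_assoc]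
  have mXY : (G * X * (G * Y)).trace = (Q₁ * (minMap H Q * Q * H⁻¹) * H₁ * minMap H Q).trace := by
    rw [hX, hY, hG, show (blockProp H Q)⁻¹ * (Q₁ * (H⁻¹ * Qᵀ)) * ((blockProp H Q)⁻¹ * (Q * H⁻¹ * H₁ * (H⁻¹ * Qᵀ)))
        = (blockProp H Q)⁻¹ * (Q₁ * (H⁻¹ * Qᵀ) * (blockProp H Q)⁻¹ * (Q * H⁻¹) * H₁ * (H⁻¹ * Qᵀ)) by simp only [Matrix.mul_assoc],
      Matrix.trace_mul_comm, ← inv_mul_transpose_mul_inv_blockProp]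
    simp only [Matrix.mul_assoc]
  have mYY : (G * Y * (G * Y)).trace = (minMap H Q * Q * H⁻¹ * H₁ * (minMap H Q * Q * H⁻¹ * H₁)).trace := by
    -- `tr(G·(QP)ḢA·G·(QP)ḢA)`: rotate the trailing `A` to the front, then `A·G·(QP) = R^Q` twice
    rw [hY, hG, show (blockProp H Q)⁻¹ * (Q * H⁻¹ * H₁ * (H⁻¹ * Qᵀ)) * ((blockProp H Q)⁻¹ * (Q * H⁻¹ * H₁ * (H⁻¹ * Qᵀ)))
        = ((blockProp H Q)⁻¹ * (Q * H⁻¹) * H₁ * (H⁻¹ * Qᵀ * (blockProp H Q)⁻¹ * (Q * H⁻¹)) * H₁) * (H⁻¹ * Qᵀ) by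
          simp only [Matrix.mul_assoc], Matrix.trace_mul_comm, range_term_eq,
      show H⁻¹ * Qᵀ * ((blockProp H Q)⁻¹ * (Q * H⁻¹) * H₁ * (minMap H Q * Q * H⁻¹) * H₁)
        = (H⁻¹ * Qᵀ * (blockProp H Q)⁻¹ * (Q * H⁻¹)) * H₁ * (minMap H Q * Q * H⁻¹ * H₁) by simp only [Matrix.mul_assoc],
      range_term_eq]
  -- expand the nine terms
  rw [hC₁]
  simp only [Matrix.mul_add, Matrix.mul_sub, Matrix.add_mul, Matrix.sub_mul, Matrix.trace_add, Matrix.trace_sub]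
  rw [cyc X' X, cyc Y X, cyc Y X', twin X' Y, twin X' X', hYt, hX't, cyc Y X, mXX, mXX', mXY, mYY]
  ring

/-- [folklore] **ROW RHOA-2, C-SECTOR: THE INDUCED POLARIZATION LOOPS IN BAŁABAN's OBJECTS.**  For a symmetric fine form `H` (`P = H⁻¹`), any
averaging `Q`, symmetric first jet `Ḣ = H₁`, any `Ḧ = H₂`, `Q̇ = Q₁`, `Q̈ = Q₂`, and the displayed jets `C₁`, `C₂` of `C = Q·P·Qᵀ` (the chain rule with
`Ṗ = −PḢP`, `P̈ = 2PḢPḢP − PḦP` applied; `QP` stands for `Aᵀ`), the one-loop functional `secondVar C C₁ C₂ = tr(C⁻¹C₂) − tr(C⁻¹C₁C⁻¹C₁)` equals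
`2tr(Q̈𝓘) − 2tr(Q̇𝓘Q̇𝓘) + 2tr(GQ̇Γ₀Q̇ᵀ) − 4tr(Q̇Γ₀Ḣ𝓘) + 2tr(R^QḢPḢ) − tr(R^QḢR^QḢ) − tr(R^QḦ)` — twice the catalogue RHOA-DESIGN §2 (i)+(ii) with
(MIX-1…4) applied (`𝓘 = minMap H Q`, `Γ₀ = constrProp H Q`, `R^Q = 𝓘·Q·H⁻¹`, `G = C⁻¹`).  No invertibility hypothesis is used: the identity is
formal in `H⁻¹` and `C⁻¹`. -/
theorem secondVar_blockProp_jets {H H₁ : Matrix ν ν ℝ} (hH : Hᵀ = H) (hH₁ : H₁ᵀ = H₁) (H₂ : Matrix ν ν ℝ) (Q Q₁ Q₂ : Matrix μ ν ℝ)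
    (C₁ C₂ : Matrix μ μ ℝ)
    (hC₁ : C₁ = Q₁ * (H⁻¹ * Qᵀ) + (Q * H⁻¹) * Q₁ᵀ - (Q * H⁻¹) * H₁ * (H⁻¹ * Qᵀ))
    (hC₂ : C₂ = Q₂ * (H⁻¹ * Qᵀ) + (Q * H⁻¹) * Q₂ᵀ - (2 : ℝ) • (Q₁ * H⁻¹ * H₁ * (H⁻¹ * Qᵀ)) - (2 : ℝ) • ((Q * H⁻¹) * H₁ * H⁻¹ * Q₁ᵀ)
      + (2 : ℝ) • (Q₁ * H⁻¹ * Q₁ᵀ) + (2 : ℝ) • ((Q * H⁻¹) * H₁ * H⁻¹ * H₁ * (H⁻¹ * Qᵀ)) - (Q * H⁻¹) * H₂ * (H⁻¹ * Qᵀ)) :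
    secondVar (blockProp H Q) C₁ C₂
      = 2 * (Q₂ * minMap H Q).trace - 2 * (Q₁ * minMap H Q * (Q₁ * minMap H Q)).trace
        + 2 * ((blockProp H Q)⁻¹ * Q₁ * constrProp H Q * Q₁ᵀ).trace - 4 * (Q₁ * constrProp H Q * H₁ * minMap H Q).trace
        + 2 * (minMap H Q * Q * H⁻¹ * H₁ * H⁻¹ * H₁).trace - (minMap H Q * Q * H⁻¹ * H₁ * (minMap H Q * Q * H⁻¹ * H₁)).trace
        - (minMap H Q * Q * H⁻¹ * H₂).trace := by
  have hT := trace_inv_mul_jet₂ hH hH₁ H₂ Q Q₁ Q₂ C₂ hC₂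
  have hB := trace_bubble_jet₁ hH hH₁ Q Q₁ C₁ hC₁
  -- the two `Γ₀ = P − R^Q` splittings
  have g1 : ((blockProp H Q)⁻¹ * Q₁ * constrProp H Q * Q₁ᵀ).trace
      = ((blockProp H Q)⁻¹ * Q₁ * H⁻¹ * Q₁ᵀ).trace - ((blockProp H Q)⁻¹ * Q₁ * (minMap H Q * Q * H⁻¹) * Q₁ᵀ).trace :=
    (mix₁ H Q Q₁).symm
  have g2 : (Q₁ * constrProp H Q * H₁ * minMap H Q).trace
      = (Q₁ * H⁻¹ * H₁ * minMap H Q).trace - (Q₁ * (minMap H Q * Q * H⁻¹) * H₁ * minMap H Q).trace := by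
    rw [constrProp_eq_sub, Matrix.mul_sub, Matrix.sub_mul, Matrix.sub_mul, Matrix.trace_sub]
  unfold secondVar
  rw [hT, hB, g1, g2]
  ring

/-! ## §4 The regrouping check: fine one loop minus induced polarization = Bałaban's one shot with legs `Γ₀` -/

/-- [folklore] **THE CHECK (memo §2 (ii)).**  For symmetric `H`, `Ḣ`:
`½(tr(PḢPḢ) − tr(PḦ)) − (tr(R^QḢPḢ) − ½tr(R^QḢR^QḢ) − ½tr(R^QḦ)) = ½tr(Γ₀ḢΓ₀Ḣ) − ½tr(Γ₀Ḧ)` — the fine unconstrained one-loop functional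
`T¹ = −½·secondVar H Ḣ Ḧ` minus the pure-`H` part of the induced polarization (the last three terms of `secondVar_blockProp_jets`, halved) is
Bałaban's one shot `½·tadpole − ½·bubble` with the CONSTRAINED covariance `Γ₀ = P − R^Q` as the leg.  (Only cyclicity is used; no symmetry in fact.) -/
theorem oneShot_regroup (H H₁ H₂ : Matrix ν ν ℝ) (Q : Matrix μ ν ℝ) :
    (1 / 2 : ℝ) * ((H⁻¹ * H₁ * (H⁻¹ * H₁)).trace - (H⁻¹ * H₂).trace)
      - ((minMap H Q * Q * H⁻¹ * H₁ * H⁻¹ * H₁).trace - (1 / 2 : ℝ) * (minMap H Q * Q * H⁻¹ * H₁ * (minMap H Q * Q * H⁻¹ * H₁)).trace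
          - (1 / 2 : ℝ) * (minMap H Q * Q * H⁻¹ * H₂).trace)
      = (1 / 2 : ℝ) * (constrProp H Q * H₁ * (constrProp H Q * H₁)).trace - (1 / 2 : ℝ) * (constrProp H Q * H₂).trace := by
  set R := minMap H Q * Q * H⁻¹ with hR
  have hΓ : constrProp H Q = H⁻¹ - R := constrProp_eq_sub H Q
  -- the cross bubble appears twice, once in each order
  have cross : (H⁻¹ * H₁ * (R * H₁)).trace = (R * H₁ * (H⁻¹ * H₁)).trace := Matrix.trace_mul_comm _ _
  have e : (R * H₁ * H⁻¹ * H₁).trace = (R * H₁ * (H⁻¹ * H₁)).trace := by rw [Matrix.mul_assoc]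
  rw [hΓ, e]
  simp only [Matrix.sub_mul, Matrix.mul_sub, Matrix.trace_sub]
  rw [cross]
  ring

/-- [folklore] THE SAME CHECK IN `secondVar` CURRENCY: `−½·secondVar H H₁ H₂ − ½·(pure-H part) = ½tr(Γ₀ḢΓ₀Ḣ) − ½tr(Γ₀Ḧ)`. -/
theorem oneShot_regroup' (H H₁ H₂ : Matrix ν ν ℝ) (Q : Matrix μ ν ℝ) :
    -(1 / 2 : ℝ) * secondVar H H₁ H₂
      - (1 / 2 : ℝ) * (2 * (minMap H Q * Q * H⁻¹ * H₁ * H⁻¹ * H₁).trace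
          - (minMap H Q * Q * H⁻¹ * H₁ * (minMap H Q * Q * H⁻¹ * H₁)).trace - (minMap H Q * Q * H⁻¹ * H₂).trace)
      = (1 / 2 : ℝ) * (constrProp H Q * H₁ * (constrProp H Q * H₁)).trace - (1 / 2 : ℝ) * (constrProp H Q * H₂).trace := by
  rw [← oneShot_regroup H H₁ H₂ Q]
  unfold secondVar
  ring

end Summit.QuantumFields.BalabanUV.Beta.FP.InducedPolarizationLoops

end
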